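import Literature.Topology.FourManifolds.CellTriangulation
import HarnessLib

/-!
# Fine refinements of finite simplicial complexes (arbitrary finite-dimensional ambient space)

A finite geometric simplicial complex `K` (Mathlib's `Geometry.SimplicialComplex`) in a
finite-dimensional real normed space `W` has refinements of arbitrarily small mesh: for every
`δ > 0` a finite complex `P` with `P.space = K.space`, every simplex of `P` inside a simplex of
`K`, every closed simplex of `K` covered by simplices of `P` inside it, and all closed simplices
of `P` of diameter `≤ δ` (`exists_refinement_diam_le`); and the form in which PL approximation
arguments use it, a refinement on whose closed simplices a given uniformly continuous map
oscillates by at most `ε` (`exists_refinement_oscillation_le`).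

This is Munkres' Lemma 9.4 (*"a finite complex has arbitrarily fine subdivisions"*) without the
thickness control, which the tree proves for *coordinate* complexes by the lattice subdivision
(`Literature.Analysis.Convexity.exists_fine_nondegenerate_refinement`), and for complexes in
`EuclideanSpace ℝ (Fin n)` inside a cube via the grid functionals `gridFun` of
`CellTriangulation` (`norm_sub_le_of_grid_signs`).  Here the ambient space is an arbitrary
finite-dimensional normed space — the generality in which the engulfing arguments need it
(prisms `|L| × I ⊆ W × ℝ`, Rushing's *"let `T₁` be a subdivision of `T` such that for any simplex
`σ₁` of `T₁`, `diam h(σ₁) < Δ`"*, and the linear-approximation step of the general position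
theorems 1.6.10–1.6.11) — obtained from the adapted refinement
`exists_adapted_refinement` of `CellTriangulation` with respect to the level functionals
`x ↦ b.coord i x - (k/m - R)` of a basis `b` of `W`: on each simplex of the refinement the
level signs are those at one of its vertices, so each coordinate varies by `≤ 1/m`
(`abs_sub_le_of_level_signs`, the scalar form of `abs_sub_le_of_grid_signs`) and the diameter
is `≤ 2 (∑ᵢ ‖bᵢ‖) / m`.

Everything is proved; the file declares theorems only (no definition, no named fact).

## References

* J. R. Munkres, *Elementary differential topology*, Ann. of Math. Studies 54 (rev. 1966), §9,
  Lemma 9.4. [Munkres1966]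
* T. B. Rushing, *Topological Embeddings*, Academic Press (1973), §1.6.D, proofs of
  Thms. 1.6.10–1.6.11; §4.13, proof of Lemma 4.13.2. [Rushing1973]
-/

open Set Function Module

noncomputable section

namespace Literature.Topology.FourManifolds

open Literature.Analysis.Convexity

/-! ### Signs of level functionals control a coordinate -/

section Levels

/-- **Mesh from level signs, scalar form.** If `|ξ| ≤ R` and, for every level
`ℓ_k = k/m - R`, `0 ≤ k ≤ 2 R m`, the sign of `η - ℓ_k` is zero or equals the sign of `ξ - ℓ_k`,
then `|η - ξ| ≤ 1/m` (the two levels bracketing `ξ` bracket `η`).  Scalar version of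
`abs_sub_le_of_grid_signs`. [folklore] -/
theorem abs_sub_le_of_level_signs {m R : ℕ} (hm : 0 < m) {ξ η : ℝ} (hξ : |ξ| ≤ R)
    (hsign : ∀ k : ℕ, k ≤ 2 * R * m →
      SignType.sign (η - ((k : ℝ) / m - R)) = 0 ∨
        SignType.sign (η - ((k : ℝ) / m - R)) = SignType.sign (ξ - ((k : ℝ) / m - R))) :
    |η - ξ| ≤ 1 / m := by
  have hm' : (0 : ℝ) < m := by exact_mod_cast hm
  have hξ' := abs_le.1 hξ
  -- the level just below `ξ`
  obtain ⟨k₀, hk₀⟩ : ∃ k₀ : ℕ, (k₀ : ℝ) ≤ (ξ + R) * m ∧ (ξ + R) * m < k₀ + 1 :=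
    ⟨⌊(ξ + R) * m⌋₊, Nat.floor_le (by nlinarith), Nat.lt_floor_add_one _⟩
  have hk₀le : k₀ ≤ 2 * R * m := by
    have h1 : (k₀ : ℝ) ≤ 2 * R * m := hk₀.1.trans (by nlinarith)
    exact_mod_cast h1
  -- sign transfer at a level `k`
  have key : ∀ k : ℕ, k ≤ 2 * R * m →
      (0 ≤ ξ - ((k : ℝ) / m - R) → 0 ≤ η - ((k : ℝ) / m - R)) ∧
      (ξ - ((k : ℝ) / m - R) ≤ 0 → η - ((k : ℝ) / m - R) ≤ 0) := by
    intro k hk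
    rcases hsign k hk with h0 | h1
    · rw [sign_eq_zero_iff] at h0
      exact ⟨fun _ => h0.symm.le, fun _ => h0.le⟩
    · constructor
      · intro hxk
        rcases hxk.lt_or_eq with hlt | heq
        · rw [sign_pos hlt] at h1
          by_contra hneg
          push Not at hneg
          rw [sign_neg hneg] at h1
          exact absurd h1 (by decide)
        · by_contra hneg
          push Not at hneg
          rw [sign_neg hneg, ← heq, sign_zero] at h1
          exact absurd h1 (by decide)
      · intro hxk
        rcases hxk.lt_or_eq with hlt | heq
        · rw [sign_neg hlt] at h1
          by_contra hpos
          push Not at hpos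
          rw [sign_pos hpos] at h1
          exact absurd h1 (by decide)
        · by_contra hpos
          push Not at hpos
          rw [sign_pos hpos, heq, sign_zero] at h1
          exact absurd h1 (by decide)
  have hℓ₀ : (k₀ : ℝ) / m - R ≤ ξ := by
    have : (k₀ : ℝ) / m ≤ ξ + R := by rw [div_le_iff₀ hm']; exact hk₀.1
    linarith
  have hℓ₁ : ξ < ((k₀ : ℝ) + 1) / m - R := by
    have : ξ + R < ((k₀ : ℝ) + 1) / m := by rw [lt_div_iff₀ hm']; exact hk₀.2
    linarith
  have h1m : ((k₀ : ℝ) + 1) / m = (k₀ : ℝ) / m + 1 / m := by rw [add_div]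
  -- lower bound from level `k₀`
  have hlow : ξ - 1 / m ≤ η := by
    have h := (key k₀ hk₀le).1 (by linarith)
    linarith
  -- upper bound from level `k₀ + 1` (or `k₀` itself at the top)
  have hup : η ≤ ξ + 1 / m := by
    rcases Nat.lt_or_ge k₀ (2 * R * m) with hlt | hge
    · have h := (key (k₀ + 1) hlt).2 (by push_cast; linarith)
      push_cast at h
      linarith
    · have hk : k₀ = 2 * R * m := le_antisymm hk₀le hge
      have hℓR : (k₀ : ℝ) / m - R = R := by
        rw [hk]; push_cast; field_simp; ring
      have hξR : ξ = R := le_antisymm hξ'.2 (by linarith)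
      have h := (key k₀ hk₀le).2 (by linarith)
      have : (0 : ℝ) ≤ 1 / m := by positivity
      linarith
  rw [abs_le]
  constructor <;> linarith

end Levels

/-! ### Fine refinements -/

section Refine

variable {W : Type*} [NormedAddCommGroup W] [NormedSpace ℝ W]

variable [FiniteDimensional ℝ W]

/-- **Fine refinement of a finite complex** (Munkres 1966, Lemma 9.4 for the mesh; Rushing's
*"Let `T₁` be a subdivision of `T` such that for any simplex `σ₁` of `T₁`, `diam h(σ₁) < Δ`"*,
used before every general-position step).  A finite geometric simplicial complex `K` in a
finite-dimensional real normed space has, for every `δ > 0`, a finite refinement `P` — same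
underlying space, every simplex of `P` inside a simplex of `K`, every closed simplex of `K`
covered simplexwise — all of whose closed simplices have diameter `≤ δ`.  Proof: the adapted
refinement of `CellTriangulation` (`exists_adapted_refinement`) with respect to the level
functionals `x ↦ b.coord i x - (k/m - R)` of a basis `b`; on each simplex the level signs are those at a vertex, so every
coordinate varies by `≤ 1/m` (`abs_sub_le_of_level_signs`) and the diameter is
`≤ 2 (∑ ‖bᵢ‖) / m`. [cite: Munkres1966, Lemma 9.4] -/
theorem exists_refinement_diam_le (K : Geometry.SimplicialComplex ℝ W) (hK : K.faces.Finite)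
    {δ : ℝ} (hδ : 0 < δ) :
    ∃ P : Geometry.SimplicialComplex ℝ W, P.faces.Finite ∧ P.space = K.space ∧
      (∀ t ∈ P.faces, ∃ s ∈ K.faces, convexHull ℝ (t : Set W) ⊆ convexHull ℝ (s : Set W)) ∧
      (∀ s ∈ K.faces, ∀ y ∈ convexHull ℝ (s : Set W), ∃ t ∈ P.faces,
        y ∈ convexHull ℝ (t : Set W) ∧ convexHull ℝ (t : Set W) ⊆ convexHull ℝ (s : Set W)) ∧
      ∀ t ∈ P.faces, ∀ x ∈ convexHull ℝ (t : Set W), ∀ y ∈ convexHull ℝ (t : Set W),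
        ‖x - y‖ ≤ δ := by
  classical
  set b := Module.finBasis ℝ W with hb
  -- a bound `R` for the coordinates on the compact underlying space
  have hcpt : IsCompact K.space := isCompact_space_of_finite hK
  obtain ⟨C, hC⟩ := hcpt.exists_bound_of_continuousOn
    (f := fun x => (b.equivFun x : Fin (finrank ℝ W) → ℝ))
    b.equivFun.toContinuousLinearEquiv.continuous.continuousOn
  set R : ℕ := ⌈C⌉₊ with hR
  have hcoordR : ∀ x ∈ K.space, ∀ i, |b.coord i x| ≤ R := fun x hx i => by
    have h1 : |b.coord i x| ≤ ‖(b.equivFun x : Fin (finrank ℝ W) → ℝ)‖ := by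
      rw [Basis.coord_apply, ← Real.norm_eq_abs, ← Basis.equivFun_apply]
      exact norm_le_pi_norm _ i
    exact h1.trans ((hC x hx).trans (Nat.le_ceil C))
  -- the mesh parameter
  set B : ℝ := ∑ i, ‖b i‖ with hB
  have hB0 : 0 ≤ B := Finset.sum_nonneg fun i _ => norm_nonneg _
  obtain ⟨m, hm, hmδ⟩ : ∃ m : ℕ, 0 < m ∧ 2 * B / m ≤ δ := by
    refine ⟨⌈2 * B / δ⌉₊ + 1, Nat.succ_pos _, ?_⟩
    have h1 : 2 * B / δ ≤ (⌈2 * B / δ⌉₊ : ℝ) := Nat.le_ceil _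
    have hpos : (0 : ℝ) < (⌈2 * B / δ⌉₊ : ℝ) + 1 := by positivity
    rw [div_le_iff₀ (by exact_mod_cast Nat.succ_pos _)]
    push_cast
    rw [div_le_iff₀ hδ] at h1
    nlinarith
  have hm' : (0 : ℝ) < m := by exact_mod_cast hm
  -- the adapted refinement with respect to the level functionals of the basis `b`:
  -- `x ↦ b.coord i x - (k/m - R)`, `0 ≤ k ≤ 2 R m`
  let L₀ : Fin (finrank ℝ W) × Fin (2 * R * m + 1) → W →ᵃ[ℝ] ℝ := fun p =>
    (b.coord p.1).toAffineMap - AffineMap.const ℝ W ((p.2 : ℝ) / m - R)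
  have hL₀ : ∀ p x, L₀ p x = b.coord p.1 x - ((p.2 : ℝ) / m - R) := fun p x => rfl
  obtain ⟨P, hPfin, hPspace, hPref, hPcov, hPvert⟩ :=
    exists_adapted_refinement K hK ∅ (by simp) L₀
  refine ⟨P, hPfin, hPspace, hPref, hPcov, fun t ht x hx y hy => ?_⟩
  obtain ⟨v, hvt, -, hsign⟩ := hPvert t ht
  have hvK : v ∈ K.space := hPspace ▸ P.convexHull_subset_space ht (subset_convexHull ℝ _ hvt)
  -- every coordinate varies by at most `1/m` on `conv t`
  have hcoord : ∀ z ∈ convexHull ℝ (t : Set W), ∀ i, |b.coord i z - b.coord i v| ≤ 1 / m := by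
    intro z hz i
    refine abs_sub_le_of_level_signs hm (hcoordR v hvK i) fun k hk => ?_
    have h := hsign (i, ⟨k, Nat.lt_succ_of_le hk⟩) z hz
    simpa only [hL₀] using h
  -- hence the distance to the vertex `v` is at most `B/m`
  have hdist : ∀ z ∈ convexHull ℝ (t : Set W), ‖z - v‖ ≤ B / m := by
    intro z hz
    calc ‖z - v‖ = ‖∑ i, b.coord i (z - v) • b i‖ := by
          simp_rw [Basis.coord_apply]; rw [b.sum_repr]
      _ ≤ ∑ i, ‖b.coord i (z - v) • b i‖ := norm_sum_le _ _
      _ = ∑ i, |b.coord i z - b.coord i v| * ‖b i‖ := by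
          simp_rw [norm_smul, map_sub, Real.norm_eq_abs]
      _ ≤ ∑ i, 1 / m * ‖b i‖ :=
          Finset.sum_le_sum fun i _ => mul_le_mul_of_nonneg_right (hcoord z hz i) (norm_nonneg _)
      _ = B / m := by rw [← Finset.mul_sum, ← hB]; ring
  calc ‖x - y‖ = ‖(x - v) - (y - v)‖ := by rw [sub_sub_sub_cancel_right]
    _ ≤ ‖x - v‖ + ‖y - v‖ := norm_sub_le _ _
    _ ≤ B / m + B / m := add_le_add (hdist x hx) (hdist y hy)
    _ = 2 * B / m := by ring
    _ ≤ δ := hmδ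

/-- **Fine refinement, mesh in terms of a modulus of continuity.** For a finite complex `K` and a
map `f` uniformly continuous on `|K|` in the sense `‖x - y‖ ≤ δ → ‖f x - f y‖ ≤ ε` on `|K|`,
there is a finite refinement `P` of `K` (same space, simplexwise finer, covering) on each closed
simplex of which `f` oscillates by at most `ε`; in particular (with
`Literature.Analysis.Convexity.norm_plMap_sub_self_le`) the simplexwise affine interpolation of
`f` on `P` is uniformly `ε`-close to `f` — the linear-approximation step of Rushing's proofs of
Thms. 1.6.10–1.6.11. [cite: Rushing1973, proof of Thm. 1.6.11] -/
theorem exists_refinement_oscillation_le (K : Geometry.SimplicialComplex ℝ W)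
    (hK : K.faces.Finite) {X : Type*} [NormedAddCommGroup X] (f : W → X) {δ ε : ℝ}
    (hδ : 0 < δ) (hf : ∀ x ∈ K.space, ∀ y ∈ K.space, ‖x - y‖ ≤ δ → ‖f x - f y‖ ≤ ε) :
    ∃ P : Geometry.SimplicialComplex ℝ W, P.faces.Finite ∧ P.space = K.space ∧
      (∀ t ∈ P.faces, ∃ s ∈ K.faces, convexHull ℝ (t : Set W) ⊆ convexHull ℝ (s : Set W)) ∧
      (∀ s ∈ K.faces, ∀ y ∈ convexHull ℝ (s : Set W), ∃ t ∈ P.faces,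
        y ∈ convexHull ℝ (t : Set W) ∧ convexHull ℝ (t : Set W) ⊆ convexHull ℝ (s : Set W)) ∧
      ∀ t ∈ P.faces, ∀ x ∈ convexHull ℝ (t : Set W), ∀ y ∈ convexHull ℝ (t : Set W),
        ‖f x - f y‖ ≤ ε := by
  obtain ⟨P, hPfin, hPspace, hPref, hPcov, hPdiam⟩ := exists_refinement_diam_le K hK hδ
  refine ⟨P, hPfin, hPspace, hPref, hPcov, fun t ht x hx y hy => hf x ?_ y ?_ (hPdiam t ht x hx y hy)⟩
  · exact hPspace ▸ P.convexHull_subset_space ht hx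
  · exact hPspace ▸ P.convexHull_subset_space ht hy

end Refine

end Literature.Topology.FourManifolds
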